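import Summits.KontsevichZagierPeriods.KontsevichZagierPeriods.Theorems.LinRedNormalFormArrangementNormalFormSeparateTaylor

/-!
# Double Taylor expansion of a bivariate numerator at a rational point

(Line `janus-bands`, crux `ArrangementNormalForm`, stub `stub_separateTwo`, part `DoubleTaylor`.)
Links the engine's Taylor data (`SeparatePos.exists_taylor`, `separatePos_taylor`) with the
power-counting brick of part `Order`: for `p ∈ ℚ[x̃, ỹ]`, a rational affine centre
`ℓ(x̃) = ℓ₁ x̃ + ℓ₀` and a rational abscissa `x_P`, the coefficients `qᵢ ∈ ℚ[x̃]` of the expansion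
`p = ∑_{i<N} qᵢ(x̃) (ỹ − ℓ(x̃))^i` themselves expand as `qᵢ(x̃) = ∑_{m<N'} c(i,m) (x̃ − x_P)^m`
with REAL constants `c(i,m)` (`exists_double_taylor`, registered as `separateTwo_doubleTaylor`),
so that `p(x_P + u, ℓ + λ) = ∑ c(i,m) u^m λ^i` is a finite double sum (`SepTwo.dsum` of part
`Order`) and every Taylor piece `qᵢ λ^i = ∑ₘ c(i,m) u^m λ^i` inherits the order of `p` at
`P = (x_P, ℓ(x_P))` (`SepTwo.term_le`).
-/

noncomputable section

open MvPolynomial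

namespace Summit.KontsevichZagierPeriods.ArrangementNormalForm.JanusBands

namespace SepTwo

/-- **Double Taylor expansion.** See the module docstring. -/
theorem exists_double_taylor (p : MvPolynomial (Fin 2) ℚ) (ℓ₁ ℓ₀ xP : ℚ) :
    ∃ (N N' : ℕ) (c : ℕ × ℕ → ℝ), ∀ x y : ℝ,
      MvPolynomial.aeval (![x, y] : Fin 2 → ℝ) p =
        ∑ i ∈ Finset.range N, (∑ m ∈ Finset.range N', c (i, m) * (x - xP) ^ m) *
          (y - ((ℓ₁ : ℝ) * x + ℓ₀)) ^ i := by
  classical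
  -- expansion in `y` around `ℓ₁ x + ℓ₀`
  obtain ⟨N, q, -, hq⟩ := SeparatePos.exists_taylor (C ℓ₁ * X 0 + C ℓ₀ : MvPolynomial (Fin 1) ℚ) p
  -- expansion of each `q i` in `x` around `xP`
  have hqi : ∀ i, ∃ (Ni : ℕ) (r : ℕ → MvPolynomial (Fin 0) ℚ), (∀ m, Ni ≤ m → r m = 0) ∧
      ∀ x : ℝ, MvPolynomial.aeval (![x] : Fin 1 → ℝ) (q i) =
        ∑ m ∈ Finset.range Ni, MvPolynomial.aeval (Fin.elim0 : Fin 0 → ℝ) (r m) * (x - xP) ^ m := by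
    intro i
    obtain ⟨Ni, r, hr0, hr⟩ := SeparatePos.exists_taylor (C xP : MvPolynomial (Fin 0) ℚ) (q i)
    refine ⟨Ni, r, hr0, fun x => ?_⟩
    have h := hr Fin.elim0 x
    have hsnoc : (Fin.snoc (Fin.elim0 : Fin 0 → ℝ) x : Fin 1 → ℝ) = ![x] := by
      funext j; fin_cases j; rfl
    rw [hsnoc] at h
    rw [h]
    simp
  choose Ni r hr0 hr using hqi
  refine ⟨N, (Finset.range N).sup Ni, fun im => MvPolynomial.aeval (Fin.elim0 : Fin 0 → ℝ) (r im.1 im.2),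
    fun x y => ?_⟩
  have h := hq ![x] y
  have hsnoc : (Fin.snoc (![x] : Fin 1 → ℝ) y : Fin 2 → ℝ) = ![x, y] := by
    funext j; fin_cases j <;> rfl
  rw [hsnoc] at h
  rw [h]
  refine Finset.sum_congr rfl fun i hi => ?_
  have hℓ : MvPolynomial.aeval (![x] : Fin 1 → ℝ) (C ℓ₁ * X 0 + C ℓ₀ : MvPolynomial (Fin 1) ℚ) =
      (ℓ₁ : ℝ) * x + ℓ₀ := by simp
  rw [hℓ, hr i x]
  congr 1
  symm
  refine SeparatePos.sum_range_extend (fun m => MvPolynomial.aeval (Fin.elim0 : Fin 0 → ℝ) (r i m) * (x - xP) ^ m)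
    (Finset.le_sup hi) fun m hm => ?_
  simp [hr0 i m hm]

end SepTwo

/-- **Double Taylor expansion of a bivariate numerator** (registered sub-goal of
`stub_separateTwo`; literal form of `SepTwo.exists_double_taylor`). -/
theorem separateTwo_doubleTaylor (p : MvPolynomial (Fin 2) ℚ) (ℓ₁ ℓ₀ xP : ℚ) : ∃ (N N' : ℕ) (c : ℕ × ℕ → ℝ), ∀ x y : ℝ, MvPolynomial.aeval (![x, y] : Fin 2 → ℝ) p = ∑ i ∈ Finset.range N, (∑ m ∈ Finset.range N', c (i, m) * (x - xP) ^ m) * (y - ((ℓ₁ : ℝ) * x + ℓ₀)) ^ i := by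
  exact SepTwo.exists_double_taylor p ℓ₁ ℓ₀ xP

end Summit.KontsevichZagierPeriods.ArrangementNormalForm.JanusBands
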